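import Literature.NumberTheory.EllipticCurves.DoubleTowerKonigProofs
import Mathlib.Algebra.Group.Subgroup.Basic
import HarnessLib

/-!
# Pinned double limits of finite abelian groups: a family of level classes compatible MODULO stable subgroups lifts

Topic `NumberTheory/EllipticCurves`; namespace `Literature.NumberTheory.EllipticCurves.DoubleTower`.  THEOREMS ONLY (no definition, no
named fact, no `sorry`, no instance).  Sequel of `DoubleTowerKonigProofs.lean`.

SETTING: a double tower of FINITE abelian groups `L n k` with commuting additive transitions `redk`, `redn`; an abelian group `H` PINNED to
it by projections `proj n k : H →+ L n k` onto which every doubly compatible family lifts (`hsurj` — the «jointly surjective» pin of the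
tree's `IwasawaH1Data`-style structures); subgroups `C n k ≤ L n k` mapped into each other by the transitions.

* `exists_proj_sub_mem_of_compatible_mod` — a family `y n k ∈ L n k` that is compatible MODULO the `C`'s (`redk (y n (k+1)) − y n k ∈ C n k`,
  `redn (y (n+1) k) − y n k ∈ C n k`) is, modulo the `C`'s, the family of projections of some `h ∈ H` (Kőnig on the cosets `y n k + C n k`).
* `proj_sub_mem_unique_mod` — two such `h` differ by an element all of whose projections lie in the `C`'s.

Consumer: (α3) ROW 2 of cell `bsd-print-cf2` (memo `ROW2-SPEC-w6g8.md` (R2-9)): the units-side map into `H¹_Iw ⧸ C̃` is DEFINED levelwise on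
classes modulo the elliptic-unit images and lifted by this lemma. HONEST FRAMING: pure algebra; nothing about BSD.

References: K. Rubin, *Euler Systems* (2000) App. B §B.3; Neukirch–Schmidt–Wingberg (2008) Ch. II §7 Cor. (2.7.6).
-/

noncomputable section

universe u v

namespace Literature.NumberTheory.EllipticCurves.DoubleTower

variable {L : ℕ → ℕ → Type u} [∀ n k, AddCommGroup (L n k)] [∀ n k, Finite (L n k)]
  (redk : ∀ n k : ℕ, L n (k + 1) →+ L n k) (redn : ∀ n k : ℕ, L (n + 1) k →+ L n k)
  {H : Type v} [AddCommGroup H] (proj : ∀ n k : ℕ, H →+ L n k)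

/-- **Compatible-modulo-`C` families lift to the pinned limit.** [cite: Rubin2000, App. B §B.3 (p. 228)] [cite: NeukirchSchmidtWingberg2008, Ch. II §7 Cor. (2.7.6)] -/
theorem exists_proj_sub_mem_of_compatible_mod
    (hcomm : ∀ (n k : ℕ) (x : L (n + 1) (k + 1)), redk n k (redn n (k + 1) x) = redn n k (redk (n + 1) k x))
    (hsurj : ∀ c : ∀ n k : ℕ, L n k, (∀ n k, redk n k (c n (k + 1)) = c n k) → (∀ n k, redn n k (c (n + 1) k) = c n k) →
      ∃ h : H, ∀ n k, proj n k h = c n k)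
    (C : ∀ n k : ℕ, AddSubgroup (L n k)) (hCk : ∀ n k, ∀ x ∈ C n (k + 1), redk n k x ∈ C n k)
    (hCn : ∀ n k, ∀ x ∈ C (n + 1) k, redn n k x ∈ C n k)
    (y : ∀ n k : ℕ, L n k) (hyk : ∀ n k, redk n k (y n (k + 1)) - y n k ∈ C n k) (hyn : ∀ n k, redn n k (y (n + 1) k) - y n k ∈ C n k) :
    ∃ h : H, ∀ n k, proj n k h - y n k ∈ C n k := by
  obtain ⟨c, hc, hck, hcn⟩ := exists_compatible_of_finite (fun n k x ↦ redk n k x) (fun n k x ↦ redn n k x) hcomm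
    (fun n k x ↦ x - y n k ∈ C n k) (fun j ↦ ⟨y j j, by rw [sub_self]; exact zero_mem _⟩)
    (fun n k x hx ↦ by
      have h : redk n k x - y n k = redk n k (x - y n (k + 1)) + (redk n k (y n (k + 1)) - y n k) := by
        rw [map_sub, sub_add_sub_cancel]
      rw [h]; exact add_mem (hCk n k _ hx) (hyk n k))
    (fun n k x hx ↦ by
      have h : redn n k x - y n k = redn n k (x - y (n + 1) k) + (redn n k (y (n + 1) k) - y n k) := by
        rw [map_sub, sub_add_sub_cancel]
      rw [h]; exact add_mem (hCn n k _ hx) (hyn n k))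
  obtain ⟨h, hh⟩ := hsurj c hck hcn
  exact ⟨h, fun n k ↦ by rw [hh]; exact hc n k⟩

omit [∀ n k, Finite (L n k)] in
/-- Uniqueness modulo the `C`'s: two lifts differ by an element with all projections in the `C`'s. [cite: Rubin2000, App. B §B.3 (p. 228)] -/
theorem proj_sub_mem_unique_mod (C : ∀ n k : ℕ, AddSubgroup (L n k)) (y : ∀ n k : ℕ, L n k) {h h' : H}
    (hh : ∀ n k, proj n k h - y n k ∈ C n k) (hh' : ∀ n k, proj n k h' - y n k ∈ C n k) (n k : ℕ) :
    proj n k (h - h') ∈ C n k := by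
  have e : proj n k (h - h') = (proj n k h - y n k) - (proj n k h' - y n k) := by rw [map_sub, sub_sub_sub_cancel_right]
  rw [e]
  exact sub_mem (hh n k) (hh' n k)

end Literature.NumberTheory.EllipticCurves.DoubleTower

end
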